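import Summits.QuantumFields.YangMills.Theorems.BalabanUVNodesN21LevelLedgerMixture

/-!
# YM-DAG node N21 (= NE7c) — ROW A′ §4, VACUITY GUARD for the SHARP-PUSH MIXTURE READING (module 12a): the binder package of
# `s_N21_of_sharpPushMixtureReading` is JOINTLY INHABITED by a one-slot toy whose sharp pieces are the indicators of the moving threshold shell, the pushes hold
# (with equality ∕ by definition), the window-averaged pieces and shell parts are POSITIVE, and `S_N21` FIRES on the reading

Track A of `YM-PLAN.md` (cell `pub-ymgap`, HUMAN RULING D-0062), node **N21**; R134 fan-out seat `pub-ymgap-dag-n21-d` (s2), generation 3, module 12c (ROW A′ of the lens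
memo v3.0 Card 6, «§4 toy guard»; dag-lead g6 REBALANCE №58).  THEOREMS ONLY: 0 `def`, 0 `sorry`, standard axioms; COUNT-NEUTRAL; `--supports` the K3′ item
`SpineGivenEndpointR12` (rev 15, stmt-QuantumFields-19908) as a helper.  Imports module 12a `BalabanUVNodesN21LevelLedgerMixture` (p472273) only (through it dag-n21-e's
file 7 and n21-a's sanity file: `T4ShellMeasureLevels.Toy.T ∕ S ∕ lvl ∕ liveWindow`, `N21AtSpineCarriers.exists_family_and_datum`).  The twin of dag-n21-e's guard
`s_N21_fires_on_mixtureSlotReading` (file 7 §4, mixture-measure currency) in the SHARP-PUSH currency of module 12a.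

THE TOY (NOT Bałaban's terms).  One term `()` and one slot `()` per step at the top level (`Toy.T`, `Toy.S`, `Toy.lvl`, window depth `0`); per slot the field law is
the Dirac mass at one point, the tested value `3∕4`, threshold `θ_j = 1`, admissible width `κ_j = 1∕2` (window `[1∕2, 1]`), relative widths `ρ_j = (1∕2)^j∕8`, [dict]
constant `M = 1`; the SHARP piece at threshold `s'` is the indicator of `s' ∈ (3∕4, 3∕(4(1 − ρ_j))]` (= «`3∕4` lies in the sharp shell `[s'(1 − ρ_j), s')`»), the sharp
weight is `1`; the carriers' pieces ∕ shell parts are the normalised window averages `2·∫_{[1∕2,1]} 𝟙_{(3∕4, 3∕(4(1−ρ_j))]}` (POSITIVE: `toyPiece_pos`; at most `1`: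
`toyPiece_le_one`) and the weights are `1 = 2·∫_{[1∕2,1]} 1` (`toyWeight_eq`); the record weight is the knit's own geometric majorant.

WHAT IS PROVED ([folklore]).  §1 toy arithmetic: `toyWindow_ne_top`, `toyB_gt` (`3∕4 < 3∕(4(1−ρ))`), `toyPush` (the sharp push, by cases on the indicator), `toyTotal`, `toyWeight_eq`,
`toyPiece_le_one`, `toyPiece_pos`.  §2 `s_N21_fires_on_sharpPushMixtureReading`: a reading predicate over `SU(2)` data that (i) IS a sharp-push
mixture reading (every pinned bundle carries module 12a §3's package), (ii) is INHABITED by a bundle with nonempty classes, positive weights, POSITIVE shell parts and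
positive record weight, (iii) satisfies `S_N21` (module 12a §3).

HONEST FRAMING.  A toy guard: it shows the hypothesis list of module 12a §2∕§3 is not contradictory and does not force vanishing shells — nothing more; nothing of
Bałaban's asserted; NE7c NOT PRINTED ∕ NOT PROVED; **N21 NOT discharged**; typed 28∕28, discharged count untouched; one finite four-torus programme at fixed `ε` —
NOT ℝ⁴, NOT infinite volume, NOT OS, NOT a mass gap, NOT Clay.  No decl below carries a cite tag.
-/

set_option autoImplicit false

noncomputable section

open scoped BigOperators ENNReal
open MeasureTheory Set

namespace Summit.QuantumFields.YangMills.Theorems.N21LevelLedgerMixtureSanity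

open Literature.MathematicalPhysics.QuantumFieldTheory.Balaban1983to89
open T4IndicatorShell (ShellWeightBound)
open T4ShellMeasureLevels (LevelLedger LiveWindow)
open T4ShellMeasureLevels.Toy (T S lvl liveWindow)
open YMDAG.UVSplit (SpineCarriers SpineRecordPred S_N21)
open N21LevelLedgerMixture (s_N21_of_sharpPushMixtureReading)

/-! ## §1 Toy arithmetic: the sharp shell in the threshold variable, the push, the window averages -/

section ToyFacts

/-- The toy window `[(1 − ½)·1, 1]` has finite Lebesgue measure. [folklore] -/
theorem toyWindow_ne_top : volume (Icc ((1 - (1 / 2 : ℝ)) * 1) 1) ≠ ∞ := by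
  rw [Real.volume_Icc]; exact ENNReal.ofReal_ne_top

/-- For `0 < ρ < 1` the sharp shell `{s' : s'(1 − ρ) ≤ 3∕4 < s'}` in the threshold variable is the interval `(3∕4, 3∕(4(1 − ρ))]`, whose right end exceeds `3∕4`.
[folklore] -/
theorem toyB_gt {ρ : ℝ} (hρ0 : 0 < ρ) (hρ1 : ρ < 1) : (3 / 4 : ℝ) < 3 / (4 * (1 - ρ)) := by
  have h1ρ : 0 < 1 - ρ := by linarith
  rw [lt_div_iff₀ (by positivity)]
  nlinarith

/-- **THE SHARP PUSH OF THE TOY** at every threshold `s'`: the indicator of `(3∕4, 3∕(4(1 − ρ))]` at `s'` is at most `1 ×` the Dirac mass of the sharp shell event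
`{s'(1 − ρ) ≤ 3∕4 ∧ 3∕4 < s'}` (equality when the event holds, `0 ≤ ·` otherwise). [folklore] -/
theorem toyPush {ρ : ℝ} (hρ1 : ρ < 1) (s' : ℝ) :
    ∑ _τ ∈ ({()} : Finset Unit), (Ioc (3 / 4 : ℝ) (3 / (4 * (1 - ρ)))).indicator (fun _ => (1 : ℝ)) s' ≤
      1 * ((Measure.dirac ()) {_x : Unit | s' * (1 - ρ) ≤ 3 / 4 ∧ 3 / 4 < s'}).toReal := by
  have h1ρ : 0 < 1 - ρ := by linarith
  rw [Finset.sum_singleton, one_mul]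
  by_cases hs : s' ∈ Ioc (3 / 4 : ℝ) (3 / (4 * (1 - ρ)))
  · have hP : s' * (1 - ρ) ≤ 3 / 4 ∧ 3 / 4 < s' := by
      refine ⟨?_, hs.1⟩
      have h2 : s' ≤ 3 / (4 * (1 - ρ)) := hs.2
      rw [le_div_iff₀ (by positivity)] at h2
      nlinarith
    have hset : {_x : Unit | s' * (1 - ρ) ≤ 3 / 4 ∧ 3 / 4 < s'} = univ := by
      ext x
      simp only [mem_setOf_eq, mem_univ, iff_true]
      exact hP
    rw [indicator_of_mem hs, hset, measure_univ, ENNReal.toReal_one]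
  · rw [indicator_of_notMem hs]
    exact ENNReal.toReal_nonneg

/-- The total push of the toy: `1 × δ(univ) ≤ Σ_{τ ∈ {()}} 1`. [folklore] -/
theorem toyTotal : 1 * ((Measure.dirac ()) (univ : Set Unit)).toReal ≤ ∑ _τ ∈ ({()} : Finset Unit), (1 : ℝ) := by
  rw [Finset.sum_singleton, measure_univ, ENNReal.toReal_one, one_mul]

/-- The toy weight IS the normalised window average of the sharp weight `1`: `1 = (½·1)⁻¹ · ∫_{[(1−½)·1, 1]} 1`. [folklore] -/
theorem toyWeight_eq : (1 : ℝ) = ((1 / 2 : ℝ) * 1)⁻¹ * ∫ _s' in Icc ((1 - (1 / 2 : ℝ)) * 1) 1, (1 : ℝ) := by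
  rw [setIntegral_const, Real.volume_real_Icc_of_le (by norm_num), smul_eq_mul]
  norm_num

/-- The toy piece is at most the toy weight `1` (the indicator is at most `1` on a window of length `½`). [folklore] -/
theorem toyPiece_le_one (ρ : ℝ) :
    ((1 / 2 : ℝ) * 1)⁻¹ * ∫ s' in Icc ((1 - (1 / 2 : ℝ)) * 1) 1, (Ioc (3 / 4 : ℝ) (3 / (4 * (1 - ρ)))).indicator (fun _ => (1 : ℝ)) s' ≤ 1 := by
  have hint : IntegrableOn (fun s' => (Ioc (3 / 4 : ℝ) (3 / (4 * (1 - ρ)))).indicator (fun _ => (1 : ℝ)) s') (Icc ((1 - (1 / 2 : ℝ)) * 1) 1) :=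
    (integrableOn_const (C := (1 : ℝ)) (hs := toyWindow_ne_top)).indicator measurableSet_Ioc
  have hle : ∫ s' in Icc ((1 - (1 / 2 : ℝ)) * 1) 1, (Ioc (3 / 4 : ℝ) (3 / (4 * (1 - ρ)))).indicator (fun _ => (1 : ℝ)) s' ≤
      ∫ _s' in Icc ((1 - (1 / 2 : ℝ)) * 1) 1, (1 : ℝ) :=
    setIntegral_mono_on hint (integrableOn_const (C := (1 : ℝ)) (hs := toyWindow_ne_top)) measurableSet_Icc
      fun s _ => indicator_apply_le' (fun _ => le_rfl) fun _ => zero_le_one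
  calc ((1 / 2 : ℝ) * 1)⁻¹ * ∫ s' in Icc ((1 - (1 / 2 : ℝ)) * 1) 1, (Ioc (3 / 4 : ℝ) (3 / (4 * (1 - ρ)))).indicator (fun _ => (1 : ℝ)) s'
      ≤ ((1 / 2 : ℝ) * 1)⁻¹ * ∫ _s' in Icc ((1 - (1 / 2 : ℝ)) * 1) 1, (1 : ℝ) := mul_le_mul_of_nonneg_left hle (by norm_num)
    _ = 1 := toyWeight_eq.symm

/-- **THE TOY PIECE IS POSITIVE**: the window `[1∕2, 1]` meets the sharp shell interval `(3∕4, 3∕(4(1−ρ))]` in `(3∕4, min 1 (3∕(4(1−ρ)))]`, of positive length.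
[folklore] -/
theorem toyPiece_pos {ρ : ℝ} (hρ0 : 0 < ρ) (hρ1 : ρ < 1) :
    0 < ((1 / 2 : ℝ) * 1)⁻¹ * ∫ s' in Icc ((1 - (1 / 2 : ℝ)) * 1) 1, (Ioc (3 / 4 : ℝ) (3 / (4 * (1 - ρ)))).indicator (fun _ => (1 : ℝ)) s' := by
  have hb := toyB_gt hρ0 hρ1
  set b : ℝ := 3 / (4 * (1 - ρ)) with hbdef
  have hmin : (3 / 4 : ℝ) < min 1 b := lt_min (by norm_num) hb
  have hsub : Ioc (3 / 4 : ℝ) (min 1 b) ⊆ Icc ((1 - (1 / 2 : ℝ)) * 1) 1 ∩ Ioc (3 / 4 : ℝ) b := fun s hs =>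
    ⟨⟨by norm_num; linarith [hs.1], hs.2.trans (min_le_left _ _)⟩, hs.1, hs.2.trans (min_le_right _ _)⟩
  have hI : ∫ s' in Icc ((1 - (1 / 2 : ℝ)) * 1) 1, (Ioc (3 / 4 : ℝ) b).indicator (fun _ => (1 : ℝ)) s' =
      volume.real (Icc ((1 - (1 / 2 : ℝ)) * 1) 1 ∩ Ioc (3 / 4 : ℝ) b) := by
    rw [setIntegral_indicator measurableSet_Ioc, setIntegral_const, smul_eq_mul, mul_one]
  refine mul_pos (by norm_num) ?_
  rw [hI]
  calc (0 : ℝ) < min 1 b - 3 / 4 := by linarith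
    _ = volume.real (Ioc (3 / 4 : ℝ) (min 1 b)) := (Real.volume_real_Ioc_of_le hmin.le).symm
    _ ≤ volume.real (Icc ((1 - (1 / 2 : ℝ)) * 1) 1 ∩ Ioc (3 / 4 : ℝ) b) :=
        measureReal_mono hsub (measure_ne_top_of_subset inter_subset_left toyWindow_ne_top)

end ToyFacts

/-! ## §2 The sharp-push mixture reading is inhabited and `S_N21` FIRES on it -/

/-- **THE SHARP-PUSH MIXTURE READING IS INHABITED AND `S_N21` FIRES ON IT.**  There is a carrier predicate `SRec` over `SU(2)` data such that (i) `SRec` IS a sharp-push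
mixture reading — every bundle it pins carries EXACTLY the binder package of module 12a's `s_N21_of_sharpPushMixtureReading`; (ii) it is INHABITED: one term and one slot per
step at the top level, Dirac field law, tested value `3∕4`, threshold `1`, width `1∕2`, relative widths `(1∕2)^j∕8`, [dict] constant `1`, sharp pieces = indicators of the
moving shell `(3∕4, 3∕(4(1−ρ_j))]`, sharp weights `1`, carriers' pieces ∕ shell parts ∕ weights the normalised window averages, record weight the knit's majorant — the bundle
has nonempty classes, weights `1`, POSITIVE shell parts (§1 `toyPiece_pos`) and positive record weight; (iii) `S_N21 SRec` (module 12a §3).  A toy, NOT Bałaban's terms.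
[folklore] -/
theorem s_N21_fires_on_sharpPushMixtureReading :
    ∃ SRec : SpineRecordPred 2,
      -- (i) `SRec` IS a sharp-push mixture reading: every pinned bundle carries module 12a §3's binder package
      (∀ (F : T4Continuum.T4Family) (D : YMDAG.UVSplit.Datum F 2) (g₀ : ℕ → ℝ) (os : List (T4Continuum.ULoop F)) (S : SpineCarriers),
        SRec F D g₀ os S →
        ∃ (σA σB : Type) (XA : ℕ → σA → Type) (XB : ℕ → σB → Type)
          (_mA : ∀ K s, MeasurableSpace (XA K s)) (_mB : ∀ K s, MeasurableSpace (XB K s))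
          (νA : ∀ K : ℕ, ℝ → ∀ s : σA, Measure (XA K s)) (νB : ∀ K : ℕ, ℝ → ∀ s : σB, Measure (XB K s))
          (_fA : ∀ K t s, IsFiniteMeasure (νA K t s)) (_fB : ∀ K t s, IsFiniteMeasure (νB K t s))
          (wA : ∀ K : ℕ, ℝ → ∀ s : σA, XA K s → ℝ) (wB : ∀ K : ℕ, ℝ → ∀ s : σB, XB K s → ℝ)
          (SA : ℕ → Finset σA) (SB : ℕ → Finset σB)
          (pieceA : ℕ → ℝ → σA → S.ι → ℝ) (pieceB : ℕ → ℝ → σB → S.ι → ℝ)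
          (lvlA : ℕ → σA → ℕ) (lvlB : ℕ → σB → ℕ) (θA κA ρA θB κB ρB : ℕ → ℝ)
          (MA : ℕ → ℝ → σA → ℝ) (MB : ℕ → ℝ → σB → ℝ)
          (pcA AsA : ∀ K : ℕ, ℝ → ∀ s : σA, ℝ → S.ι → ℝ) (pcB AsB : ∀ K : ℕ, ℝ → ∀ s : σB, ℝ → S.ι → ℝ)
          (N₁ : ℕ) (νbar κmin c₁ ϑ : ℝ),
          (∀ K t, |t| ≤ S.l₀ → ∀ τ ∈ S.T K, 0 ≤ S.shA K t τ) ∧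
          (∀ K t, |t| ≤ S.l₀ → ∀ τ ∈ S.T K, S.shA K t τ ≤ S.A K t τ) ∧
          (∀ K t, |t| ≤ S.l₀ → ∀ τ ∈ S.T K, S.shA K t τ ≤ ∑ s ∈ SA K, pieceA K t s τ) ∧
          (∀ K t s, Measurable (wA K t s)) ∧ (∀ j, 0 < θA j) ∧ (∀ j, 0 < κA j ∧ κA j < 1) ∧ (∀ j, 0 ≤ ρA j) ∧
          (∀ K t, |t| ≤ S.l₀ → ∀ s ∈ SA K, 0 ≤ MA K t s) ∧
          (∀ K t, |t| ≤ S.l₀ → ∀ s ∈ SA K, ∀ τ ∈ S.T K,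
            IntegrableOn (fun s' => pcA K t s s' τ) (Icc ((1 - κA (lvlA K s)) * θA (lvlA K s)) (θA (lvlA K s)))) ∧
          (∀ K t, |t| ≤ S.l₀ → ∀ s ∈ SA K, ∀ τ ∈ S.T K,
            IntegrableOn (fun s' => AsA K t s s' τ) (Icc ((1 - κA (lvlA K s)) * θA (lvlA K s)) (θA (lvlA K s)))) ∧
          (∀ K t, |t| ≤ S.l₀ → ∀ s ∈ SA K, ∀ s' ∈ Icc ((1 - κA (lvlA K s)) * θA (lvlA K s)) (θA (lvlA K s)),
            ∑ τ ∈ S.T K, pcA K t s s' τ ≤ MA K t s * (νA K t s {x | s' * (1 - ρA (lvlA K s)) ≤ wA K t s x ∧ wA K t s x < s'}).toReal) ∧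
          (∀ K t, |t| ≤ S.l₀ → ∀ s ∈ SA K, ∀ s' ∈ Icc ((1 - κA (lvlA K s)) * θA (lvlA K s)) (θA (lvlA K s)),
            MA K t s * (νA K t s univ).toReal ≤ ∑ τ ∈ S.T K, AsA K t s s' τ) ∧
          (∀ K t, |t| ≤ S.l₀ → ∀ s ∈ SA K, ∀ τ ∈ S.T K, pieceA K t s τ =
            (κA (lvlA K s) * θA (lvlA K s))⁻¹ * ∫ s' in Icc ((1 - κA (lvlA K s)) * θA (lvlA K s)) (θA (lvlA K s)), pcA K t s s' τ) ∧
          (∀ K t, |t| ≤ S.l₀ → ∀ s ∈ SA K, ∀ τ ∈ S.T K, S.A K t τ =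
            (κA (lvlA K s) * θA (lvlA K s))⁻¹ * ∫ s' in Icc ((1 - κA (lvlA K s)) * θA (lvlA K s)) (θA (lvlA K s)), AsA K t s s' τ) ∧
          (∀ K t, |t| ≤ S.l₀ → ∀ τ ∈ S.T K, 0 ≤ S.shB K t τ) ∧
          (∀ K t, |t| ≤ S.l₀ → ∀ τ ∈ S.T K, S.shB K t τ ≤ S.B K t τ) ∧
          (∀ K t, |t| ≤ S.l₀ → ∀ τ ∈ S.T K, S.shB K t τ ≤ ∑ s ∈ SB K, pieceB K t s τ) ∧
          (∀ K t s, Measurable (wB K t s)) ∧ (∀ j, 0 < θB j) ∧ (∀ j, 0 < κB j ∧ κB j < 1) ∧ (∀ j, 0 ≤ ρB j) ∧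
          (∀ K t, |t| ≤ S.l₀ → ∀ s ∈ SB K, 0 ≤ MB K t s) ∧
          (∀ K t, |t| ≤ S.l₀ → ∀ s ∈ SB K, ∀ τ ∈ S.T K,
            IntegrableOn (fun s' => pcB K t s s' τ) (Icc ((1 - κB (lvlB K s)) * θB (lvlB K s)) (θB (lvlB K s)))) ∧
          (∀ K t, |t| ≤ S.l₀ → ∀ s ∈ SB K, ∀ τ ∈ S.T K,
            IntegrableOn (fun s' => AsB K t s s' τ) (Icc ((1 - κB (lvlB K s)) * θB (lvlB K s)) (θB (lvlB K s)))) ∧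
          (∀ K t, |t| ≤ S.l₀ → ∀ s ∈ SB K, ∀ s' ∈ Icc ((1 - κB (lvlB K s)) * θB (lvlB K s)) (θB (lvlB K s)),
            ∑ τ ∈ S.T K, pcB K t s s' τ ≤ MB K t s * (νB K t s {x | s' * (1 - ρB (lvlB K s)) ≤ wB K t s x ∧ wB K t s x < s'}).toReal) ∧
          (∀ K t, |t| ≤ S.l₀ → ∀ s ∈ SB K, ∀ s' ∈ Icc ((1 - κB (lvlB K s)) * θB (lvlB K s)) (θB (lvlB K s)),
            MB K t s * (νB K t s univ).toReal ≤ ∑ τ ∈ S.T K, AsB K t s s' τ) ∧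
          (∀ K t, |t| ≤ S.l₀ → ∀ s ∈ SB K, ∀ τ ∈ S.T K, pieceB K t s τ =
            (κB (lvlB K s) * θB (lvlB K s))⁻¹ * ∫ s' in Icc ((1 - κB (lvlB K s)) * θB (lvlB K s)) (θB (lvlB K s)), pcB K t s s' τ) ∧
          (∀ K t, |t| ≤ S.l₀ → ∀ s ∈ SB K, ∀ τ ∈ S.T K, S.B K t τ =
            (κB (lvlB K s) * θB (lvlB K s))⁻¹ * ∫ s' in Icc ((1 - κB (lvlB K s)) * θB (lvlB K s)) (θB (lvlB K s)), AsB K t s s' τ) ∧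
          LiveWindow SA lvlA N₁ νbar ∧ LiveWindow SB lvlB N₁ νbar ∧ 0 < κmin ∧ (∀ j, κmin ≤ κA j) ∧ (∀ j, κmin ≤ κB j) ∧
          0 < ϑ ∧ ϑ < 1 ∧ (∀ j, ρA j ≤ c₁ * ϑ ^ j) ∧ (∀ j, ρB j ≤ c₁ * ϑ ^ j) ∧
          (∀ K, (2 * ((N₁ + 1) * νbar * (2 * κmin⁻¹) * c₁ * ϑ⁻¹ ^ N₁)) * ϑ ^ K ≤ S.Wsh K) ∧ Summable S.Wsh) ∧
      -- (ii) it is INHABITED, non-degenerately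
      (∃ (F : T4Continuum.T4Family) (D : YMDAG.UVSplit.Datum F 2) (g₀ : ℕ → ℝ) (os : List (T4Continuum.ULoop F))
          (Sb : SpineCarriers), SRec F D g₀ os Sb ∧ (∀ K, (Sb.T K).Nonempty) ∧
          (∀ K t τ, 0 < Sb.A K t τ ∧ 0 < Sb.B K t τ ∧ 0 < Sb.shA K t τ ∧ 0 < Sb.shB K t τ) ∧ ∀ K, 0 < Sb.Wsh K) ∧
      -- (iii) `S_N21` fires on it
      S_N21 SRec := by
  obtain ⟨F, ⟨Dat⟩⟩ := N21AtSpineCarriers.exists_family_and_datum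
  -- the toy letters
  let ρ : ℕ → ℝ := fun j => (1 / 2 : ℝ) ^ j / 8
  let pc : ℕ → ℝ → ℝ := fun j s' => (Ioc (3 / 4 : ℝ) (3 / (4 * (1 - ρ j)))).indicator (fun _ => (1 : ℝ)) s'
  let piece : ℕ → ℝ := fun j => ((1 / 2 : ℝ) * 1)⁻¹ * ∫ s' in Icc ((1 - (1 / 2 : ℝ)) * 1) 1, pc j s'
  let Wsh : ℕ → ℝ := fun K =>
    (2 * ((((0 : ℕ) : ℝ) + 1) * (1 : ℝ) * (2 * (1 / 2 : ℝ)⁻¹) * (1 / 8 : ℝ) * (1 / 2 : ℝ)⁻¹ ^ (0 : ℕ))) * (1 / 2 : ℝ) ^ K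
  have hρ0 : ∀ j, 0 < ρ j := fun j => by positivity
  have hρ1 : ∀ j, ρ j < 1 := fun j => by
    have : (1 / 2 : ℝ) ^ j ≤ 1 := pow_le_one₀ (by norm_num) (by norm_num)
    show (1 / 2 : ℝ) ^ j / 8 < 1
    linarith
  have hpiece_pos : ∀ j, 0 < piece j := fun j => toyPiece_pos (hρ0 j) (hρ1 j)
  have hpiece_le : ∀ j, piece j ≤ 1 := fun j => toyPiece_le_one (ρ j)
  have hWpos : ∀ K, 0 < Wsh K := fun K => by positivity
  have hWsum : Summable Wsh := (summable_geometric_of_lt_one (by norm_num) (by norm_num : (1 / 2 : ℝ) < 1)).mul_left _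
  -- the bundle: one term per step, weights 1, shell parts = the averaged pieces, in both runs
  let Sb : SpineCarriers :=
    { ι := Unit, l₀ := 1, vol := 1, K₀ := 0, T := T, A := fun _ _ _ => 1, B := fun _ _ _ => 1,
      shA := fun K _ _ => piece K, shB := fun K _ _ => piece K, Bad := fun _ _ => ∅, W := fun _ => 0, Wsh := Wsh, δ := fun _ => 0 }
  -- the reading package at the toy data (both runs identical)
  have hpkg : ∀ Sc : SpineCarriers, Sc = Sb →
      ∃ (σA σB : Type) (XA : ℕ → σA → Type) (XB : ℕ → σB → Type)
        (_mA : ∀ K s, MeasurableSpace (XA K s)) (_mB : ∀ K s, MeasurableSpace (XB K s))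
        (νA : ∀ K : ℕ, ℝ → ∀ s : σA, Measure (XA K s)) (νB : ∀ K : ℕ, ℝ → ∀ s : σB, Measure (XB K s))
        (_fA : ∀ K t s, IsFiniteMeasure (νA K t s)) (_fB : ∀ K t s, IsFiniteMeasure (νB K t s))
        (wA : ∀ K : ℕ, ℝ → ∀ s : σA, XA K s → ℝ) (wB : ∀ K : ℕ, ℝ → ∀ s : σB, XB K s → ℝ)
        (SA : ℕ → Finset σA) (SB : ℕ → Finset σB)
        (pieceA : ℕ → ℝ → σA → Sc.ι → ℝ) (pieceB : ℕ → ℝ → σB → Sc.ι → ℝ)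
        (lvlA : ℕ → σA → ℕ) (lvlB : ℕ → σB → ℕ) (θA κA ρA θB κB ρB : ℕ → ℝ)
        (MA : ℕ → ℝ → σA → ℝ) (MB : ℕ → ℝ → σB → ℝ)
        (pcA AsA : ∀ K : ℕ, ℝ → ∀ s : σA, ℝ → Sc.ι → ℝ) (pcB AsB : ∀ K : ℕ, ℝ → ∀ s : σB, ℝ → Sc.ι → ℝ)
        (N₁ : ℕ) (νbar κmin c₁ ϑ : ℝ),
        (∀ K t, |t| ≤ Sc.l₀ → ∀ τ ∈ Sc.T K, 0 ≤ Sc.shA K t τ) ∧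
        (∀ K t, |t| ≤ Sc.l₀ → ∀ τ ∈ Sc.T K, Sc.shA K t τ ≤ Sc.A K t τ) ∧
        (∀ K t, |t| ≤ Sc.l₀ → ∀ τ ∈ Sc.T K, Sc.shA K t τ ≤ ∑ s ∈ SA K, pieceA K t s τ) ∧
        (∀ K t s, Measurable (wA K t s)) ∧ (∀ j, 0 < θA j) ∧ (∀ j, 0 < κA j ∧ κA j < 1) ∧ (∀ j, 0 ≤ ρA j) ∧
        (∀ K t, |t| ≤ Sc.l₀ → ∀ s ∈ SA K, 0 ≤ MA K t s) ∧
        (∀ K t, |t| ≤ Sc.l₀ → ∀ s ∈ SA K, ∀ τ ∈ Sc.T K,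
          IntegrableOn (fun s' => pcA K t s s' τ) (Icc ((1 - κA (lvlA K s)) * θA (lvlA K s)) (θA (lvlA K s)))) ∧
        (∀ K t, |t| ≤ Sc.l₀ → ∀ s ∈ SA K, ∀ τ ∈ Sc.T K,
          IntegrableOn (fun s' => AsA K t s s' τ) (Icc ((1 - κA (lvlA K s)) * θA (lvlA K s)) (θA (lvlA K s)))) ∧
        (∀ K t, |t| ≤ Sc.l₀ → ∀ s ∈ SA K, ∀ s' ∈ Icc ((1 - κA (lvlA K s)) * θA (lvlA K s)) (θA (lvlA K s)),
          ∑ τ ∈ Sc.T K, pcA K t s s' τ ≤ MA K t s * (νA K t s {x | s' * (1 - ρA (lvlA K s)) ≤ wA K t s x ∧ wA K t s x < s'}).toReal) ∧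
        (∀ K t, |t| ≤ Sc.l₀ → ∀ s ∈ SA K, ∀ s' ∈ Icc ((1 - κA (lvlA K s)) * θA (lvlA K s)) (θA (lvlA K s)),
          MA K t s * (νA K t s univ).toReal ≤ ∑ τ ∈ Sc.T K, AsA K t s s' τ) ∧
        (∀ K t, |t| ≤ Sc.l₀ → ∀ s ∈ SA K, ∀ τ ∈ Sc.T K, pieceA K t s τ =
          (κA (lvlA K s) * θA (lvlA K s))⁻¹ * ∫ s' in Icc ((1 - κA (lvlA K s)) * θA (lvlA K s)) (θA (lvlA K s)), pcA K t s s' τ) ∧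
        (∀ K t, |t| ≤ Sc.l₀ → ∀ s ∈ SA K, ∀ τ ∈ Sc.T K, Sc.A K t τ =
          (κA (lvlA K s) * θA (lvlA K s))⁻¹ * ∫ s' in Icc ((1 - κA (lvlA K s)) * θA (lvlA K s)) (θA (lvlA K s)), AsA K t s s' τ) ∧
        (∀ K t, |t| ≤ Sc.l₀ → ∀ τ ∈ Sc.T K, 0 ≤ Sc.shB K t τ) ∧
        (∀ K t, |t| ≤ Sc.l₀ → ∀ τ ∈ Sc.T K, Sc.shB K t τ ≤ Sc.B K t τ) ∧
        (∀ K t, |t| ≤ Sc.l₀ → ∀ τ ∈ Sc.T K, Sc.shB K t τ ≤ ∑ s ∈ SB K, pieceB K t s τ) ∧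
        (∀ K t s, Measurable (wB K t s)) ∧ (∀ j, 0 < θB j) ∧ (∀ j, 0 < κB j ∧ κB j < 1) ∧ (∀ j, 0 ≤ ρB j) ∧
        (∀ K t, |t| ≤ Sc.l₀ → ∀ s ∈ SB K, 0 ≤ MB K t s) ∧
        (∀ K t, |t| ≤ Sc.l₀ → ∀ s ∈ SB K, ∀ τ ∈ Sc.T K,
          IntegrableOn (fun s' => pcB K t s s' τ) (Icc ((1 - κB (lvlB K s)) * θB (lvlB K s)) (θB (lvlB K s)))) ∧
        (∀ K t, |t| ≤ Sc.l₀ → ∀ s ∈ SB K, ∀ τ ∈ Sc.T K,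
          IntegrableOn (fun s' => AsB K t s s' τ) (Icc ((1 - κB (lvlB K s)) * θB (lvlB K s)) (θB (lvlB K s)))) ∧
        (∀ K t, |t| ≤ Sc.l₀ → ∀ s ∈ SB K, ∀ s' ∈ Icc ((1 - κB (lvlB K s)) * θB (lvlB K s)) (θB (lvlB K s)),
          ∑ τ ∈ Sc.T K, pcB K t s s' τ ≤ MB K t s * (νB K t s {x | s' * (1 - ρB (lvlB K s)) ≤ wB K t s x ∧ wB K t s x < s'}).toReal) ∧
        (∀ K t, |t| ≤ Sc.l₀ → ∀ s ∈ SB K, ∀ s' ∈ Icc ((1 - κB (lvlB K s)) * θB (lvlB K s)) (θB (lvlB K s)),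
          MB K t s * (νB K t s univ).toReal ≤ ∑ τ ∈ Sc.T K, AsB K t s s' τ) ∧
        (∀ K t, |t| ≤ Sc.l₀ → ∀ s ∈ SB K, ∀ τ ∈ Sc.T K, pieceB K t s τ =
          (κB (lvlB K s) * θB (lvlB K s))⁻¹ * ∫ s' in Icc ((1 - κB (lvlB K s)) * θB (lvlB K s)) (θB (lvlB K s)), pcB K t s s' τ) ∧
        (∀ K t, |t| ≤ Sc.l₀ → ∀ s ∈ SB K, ∀ τ ∈ Sc.T K, Sc.B K t τ =
          (κB (lvlB K s) * θB (lvlB K s))⁻¹ * ∫ s' in Icc ((1 - κB (lvlB K s)) * θB (lvlB K s)) (θB (lvlB K s)), AsB K t s s' τ) ∧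
        LiveWindow SA lvlA N₁ νbar ∧ LiveWindow SB lvlB N₁ νbar ∧ 0 < κmin ∧ (∀ j, κmin ≤ κA j) ∧ (∀ j, κmin ≤ κB j) ∧
        0 < ϑ ∧ ϑ < 1 ∧ (∀ j, ρA j ≤ c₁ * ϑ ^ j) ∧ (∀ j, ρB j ≤ c₁ * ϑ ^ j) ∧
        (∀ K, (2 * ((N₁ + 1) * νbar * (2 * κmin⁻¹) * c₁ * ϑ⁻¹ ^ N₁)) * ϑ ^ K ≤ Sc.Wsh K) ∧ Summable Sc.Wsh := by
    rintro Sc rfl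
    -- the one-run package (used twice)
    have hsh0 : ∀ (K : ℕ) (t : ℝ), |t| ≤ (1 : ℝ) → ∀ τ ∈ T K, 0 ≤ piece K := fun K _ _ _ _ => (hpiece_pos K).le
    have hshle : ∀ (K : ℕ) (t : ℝ), |t| ≤ (1 : ℝ) → ∀ τ ∈ T K, piece K ≤ (1 : ℝ) := fun K _ _ _ _ => hpiece_le K
    have hcov : ∀ (K : ℕ) (t : ℝ), |t| ≤ (1 : ℝ) → ∀ τ ∈ T K, piece K ≤ ∑ _s ∈ S K, piece K := fun K _ _ _ _ => by
      simp [S]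
    have hpc_int : ∀ (K : ℕ) (t : ℝ), |t| ≤ (1 : ℝ) → ∀ s ∈ S K, ∀ τ ∈ T K,
        IntegrableOn (fun s' => pc (lvl K s) s') (Icc ((1 - (1 / 2 : ℝ)) * 1) 1) := fun K _ _ s _ _ _ =>
      (integrableOn_const (C := (1 : ℝ)) (hs := toyWindow_ne_top)).indicator measurableSet_Ioc
    have hAs_int : ∀ (K : ℕ) (t : ℝ), |t| ≤ (1 : ℝ) → ∀ s ∈ S K, ∀ τ ∈ T K,
        IntegrableOn (fun _s' : ℝ => (1 : ℝ)) (Icc ((1 - (1 / 2 : ℝ)) * 1) 1) := fun _ _ _ _ _ _ _ => integrableOn_const (C := (1 : ℝ)) (hs := toyWindow_ne_top)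
    have hpush : ∀ (K : ℕ) (t : ℝ), |t| ≤ (1 : ℝ) → ∀ s ∈ S K, ∀ s' ∈ Icc ((1 - (1 / 2 : ℝ)) * 1) 1,
        ∑ _τ ∈ T K, pc (lvl K s) s' ≤ 1 * ((Measure.dirac ()) {_x : Unit | s' * (1 - ρ (lvl K s)) ≤ 3 / 4 ∧ 3 / 4 < s'}).toReal :=
      fun K _ _ s _ s' _ => toyPush (hρ1 _) s'
    have htotal : ∀ (K : ℕ) (t : ℝ), |t| ≤ (1 : ℝ) → ∀ s ∈ S K, ∀ s' ∈ Icc ((1 - (1 / 2 : ℝ)) * 1) 1,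
        1 * ((Measure.dirac ()) (univ : Set Unit)).toReal ≤ ∑ _τ ∈ T K, (1 : ℝ) := fun _ _ _ _ _ _ _ => toyTotal
    have hpieceMix : ∀ (K : ℕ) (t : ℝ), |t| ≤ (1 : ℝ) → ∀ s ∈ S K, ∀ τ ∈ T K, piece K =
        ((1 / 2 : ℝ) * 1)⁻¹ * ∫ s' in Icc ((1 - (1 / 2 : ℝ)) * 1) 1, pc (lvl K s) s' := fun K _ _ s _ _ _ => rfl
    have hAMix : ∀ (K : ℕ) (t : ℝ), |t| ≤ (1 : ℝ) → ∀ s ∈ S K, ∀ τ ∈ T K, (1 : ℝ) =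
        ((1 / 2 : ℝ) * 1)⁻¹ * ∫ _s' in Icc ((1 - (1 / 2 : ℝ)) * 1) 1, (1 : ℝ) := fun _ _ _ _ _ _ _ => toyWeight_eq
    have hrate : ∀ j, ρ j ≤ 1 / 8 * (1 / 2 : ℝ) ^ j := fun j => by show (1 / 2 : ℝ) ^ j / 8 ≤ _; linarith
    exact ⟨Unit, Unit, fun _ _ => Unit, fun _ _ => Unit, inferInstance, inferInstance,
      fun _ _ _ => Measure.dirac (), fun _ _ _ => Measure.dirac (), fun _ _ _ => inferInstance, fun _ _ _ => inferInstance,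
      fun _ _ _ _ => (3 / 4 : ℝ), fun _ _ _ _ => (3 / 4 : ℝ), S, S, fun K _ _ _ => piece K, fun K _ _ _ => piece K, lvl, lvl,
      fun _ => (1 : ℝ), fun _ => (1 / 2 : ℝ), ρ, fun _ => (1 : ℝ), fun _ => (1 / 2 : ℝ), ρ, fun _ _ _ => (1 : ℝ), fun _ _ _ => (1 : ℝ),
      fun K _ s s' _ => pc (lvl K s) s', fun _ _ _ _ _ => (1 : ℝ), fun K _ s s' _ => pc (lvl K s) s', fun _ _ _ _ _ => (1 : ℝ),
      0, (1 : ℝ), (1 / 2 : ℝ), (1 / 8 : ℝ), (1 / 2 : ℝ),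
      hsh0, hshle, hcov, fun _ _ _ => measurable_const, fun _ => one_pos, fun _ => by norm_num, fun j => (hρ0 j).le,
      fun _ _ _ _ _ => zero_le_one, hpc_int, hAs_int, hpush, htotal, hpieceMix, hAMix,
      hsh0, hshle, hcov, fun _ _ _ => measurable_const, fun _ => one_pos, fun _ => by norm_num, fun j => (hρ0 j).le,
      fun _ _ _ _ _ => zero_le_one, hpc_int, hAs_int, hpush, htotal, hpieceMix, hAMix,
      liveWindow, liveWindow, by norm_num, fun _ => le_refl (1 / 2 : ℝ), fun _ => le_refl (1 / 2 : ℝ), by norm_num, by norm_num,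
      hrate, hrate, fun K => le_rfl, hWsum⟩
  refine ⟨fun _ _ _ _ Sc => Sc = Sb, fun _ _ _ _ Sc hS => hpkg Sc hS,
    ⟨F, Dat, fun _ => 0, [], Sb, rfl, fun K => ⟨(), by simp [Sb, T]⟩, fun K t τ => ?_, hWpos⟩,
    s_N21_of_sharpPushMixtureReading _ fun _ _ _ _ Sc hS => hpkg Sc hS⟩
  exact ⟨by norm_num [Sb], by norm_num [Sb], hpiece_pos K, hpiece_pos K⟩

end Summit.QuantumFields.YangMills.Theorems.N21LevelLedgerMixtureSanity

end
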